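import Mathlib
import Summits.Langlands.Langlands.Theorems.SkinnerWilesDefectOneEisensteinProModularSeedInertBMPrimeSupply
import HarnessLib

/-!
# Inert level-raising primes `M ≡ -1 (mod p²)` in the class of complex conjugation (stub S1')

Route `SkinnerWilesDefectOne`, crux `Summit.Langlands.Langlands.Theses.SkinnerWilesDefectOne.EisensteinProModularSeed`
(stmt-Langlands-12920), line `descend-raise-basechange` (skeleton v3).  This file PROVES the
registered stub `stub_inertSupplyPrimeSq`: for `F` imaginary quadratic, `p ≥ 5` and a continuous
unit-valued `η : Γ_ℚ → ℚ̄_pˣ` with ODD reduction `η̄`, there is a rational prime `M ≠ p`, INERT in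
`F` (`M 𝓞_F` prime), at which `η̄` is unramified, with `η̄(Frob_M) ≡ -1` at every arithmetic
Frobenius above `M` and `M ≡ -1 (mod p²)`.  Everything is proved; no definition, no named fact.

It is the wave-1 construction of `stub_inertBMPrimeSupply`
(`…EisensteinProModularSeedInertBMPrimeSupply`, Case A: a Frobenius in the class of a complex
conjugation `c`), run with the cyclotomic character modulo `N = p²` instead of modulo `p`, and
without the Mazur-corner case split:

* `exists_inert_prime_modN` (Chebotarev step, general modulus `N`): for an open normal `H ≤ Γ_ℚ`
  and `g` acting nontrivially on `F`, the arithmetic Frobenius elements at places outside a finite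
  set are dense in `Γ_ℚ` (`absoluteGaloisGroup.frobenius_dense`, fed by the tree's PROVED
  `chebotarev_artinRep_holds`), so some Frobenius `σ` above a place `v = (M)`, `v ∤ N`, unramified
  in `F` and for `H`, `Gal(ℚ̄/F)`, lies in `g (H ∩ ker χ_N ∩ Gal(ℚ̄/F))`; then `v` is inert in `F`
  (`exists_place_inert_of_not_mem_range`, `Rat.isPrime_span_natCast_of_unique_place`) and
  `χ_N(g) = χ_N(σ) ≡ M (mod N)` (`modNCyclotomicCharacter_eq_residueCard_of_isArithFrobAt`).
* `stub_inertSupplyPrimeSq`: `H` the residual kernel of `η` (`exists_residualKernel`), `N = p²`,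
  `g = c` a complex conjugation (`Rat.not_mem_range_absGaloisRestrict_of_isComplexConjugation`):
  `η̄(Frob) = η̄(c) = -1` at every Frobenius above `M` by conjugacy of the primes above `M`, and
  `M ≡ χ_{p²}(c) = -1 (mod p²)` (`modNCyclotomicCharacter_of_isComplexConjugation`).

References: N. Billerey, R. Menares, *On the modularity of reducible mod l Galois
representations*, Math. Res. Lett. 23 (2016), Thm. 2.2 (the use of such `M`); J. Tate, *Global
class field theory*, in Cassels–Fröhlich (1967), §2.4 (Chebotarev) [TateGCFT1967]; J. Neukirch,
*Algebraic Number Theory* (1999), Ch. I §§8–10 [NeukirchANT1999].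
-/

-- the registered namespace `Summit.Langlands.Langlands.…` repeats `Langlands` (summit = problem)
set_option linter.dupNamespace false

noncomputable section

open Field NumberField IsDedekindDomain
open scoped Pointwise
open Literature.NumberTheory.GaloisRepresentations

namespace Summit.Langlands.Langlands.Theorems.SkinnerWilesDefectOne.EisensteinProModularSeed

/-! ### The Chebotarev step modulo a general `N` -/

/-- **The prime `M` of the line, modulo `N` (Chebotarev step).**  `F` imaginary quadratic (Galois
of degree `2` over `ℚ`), `N ≥ 1`, `H ≤ Γ_ℚ` an open normal subgroup and `g ∈ Γ_ℚ` acting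
nontrivially on `F`.  There is a rational prime `M ∤ N`, INERT in `F` (`M 𝓞_F` prime), below a
place `v ∤ N` of `ℚ` unramified for `H` (all inertia groups above `v` lie in `H`), with
`χ_N(g) ≡ M (mod N)` and an arithmetic Frobenius `σ` above `v` in the coset `g H`.  Proof: the
arithmetic Frobenius elements at places outside a finite set are dense in `Γ_ℚ` (Chebotarev,
`absoluteGaloisGroup.frobenius_dense` fed by the tree's proved `chebotarev_artinRep_holds`), so
one lies in the open coset `g (H ∩ ker χ_N ∩ Gal(ℚ̄/F))` and above a place `v ∤ N` unramified in
`F` and for `H`, `Gal(ℚ̄/F)`; it acts nontrivially on `F`, so `v` is inert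
(`exists_place_inert_of_not_mem_range`), and `χ_N(σ) = N v = M`
(`modNCyclotomicCharacter_eq_residueCard_of_isArithFrobAt`).  Adapted from the wave-1
`exists_inert_prime` (same file family, modulus `p`). [folklore] -/
theorem exists_inert_prime_modN (F : Type) [Field F] [NumberField F] [IsGalois ℚ F]
    (h2 : Module.finrank ℚ F = 2) (N : ℕ) [NeZero N] [NeZero (N : ℚ)]
    (H : Subgroup (absoluteGaloisGroup ℚ)) [H.Normal] (hH : IsOpen (H : Set (absoluteGaloisGroup ℚ)))
    {g : absoluteGaloisGroup ℚ}
    (hg : g ∉ ((absGaloisRestrict ℚ F).range : Subgroup (absoluteGaloisGroup ℚ))) :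
    ∃ (M : ℕ) (v : HeightOneSpectrum (𝓞 ℚ)), M.Prime ∧ (M : 𝓞 ℚ) ∈ v.asIdeal ∧
      (N : 𝓞 ℚ) ∉ v.asIdeal ∧
      (∀ w : HeightOneSpectrum (𝓞 ℚ), (M : 𝓞 ℚ) ∈ w.asIdeal → w = v) ∧
      (Ideal.span {(M : 𝓞 F)}).IsPrime ∧
      (∀ 𝔓 ∈ v.primesAbove, 𝔓.inertia (absoluteGaloisGroup ℚ) ≤ H) ∧
      ((modNCyclotomicCharacter ℚ N g : (ZMod N)ˣ) : ZMod N) = M ∧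
      ∃ 𝔓 ∈ v.primesAbove, ∃ σ : absoluteGaloisGroup ℚ, IsArithFrobAt (𝓞 ℚ) σ 𝔓 ∧ g⁻¹ * σ ∈ H := by
  -- adapted from `exists_inert_prime` in …EisensteinProModularSeedInertBMPrimeSupply (wave 1)
  classical
  haveI : FiniteDimensional ℚ F := Module.finite_of_finrank_eq_succ h2
  have hprime : (Module.finrank ℚ F).Prime := by rw [h2]; exact Nat.prime_two
  set HF : Subgroup (absoluteGaloisGroup ℚ) := (absGaloisRestrict ℚ F).range with hHF
  haveI hHFn : HF.Normal := normal_range_absGaloisRestrict ℚ F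
  have hHFi : HF.index = Module.finrank ℚ F := SorensenPatching.index_range_absGaloisRestrict ℚ F
  have hHFo : IsOpen (HF : Set (absoluteGaloisGroup ℚ)) :=
    SorensenPatching.isOpen_range_absGaloisRestrict ℚ F
  set ω := modNCyclotomicCharacter ℚ N with hω
  have hKo : IsOpen (ω.ker : Set (absoluteGaloisGroup ℚ)) :=
    Subgroup.isOpen_of_mem_nhds _ (g := 1) (modNCyclotomicCharacter_eventually_eq_one ℚ N)
  -- the open coset `U = g (H ∩ ker ω ∩ HF)`
  set H' : Subgroup (absoluteGaloisGroup ℚ) := H ⊓ ω.ker ⊓ HF with hH'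
  have hH'o : IsOpen (H' : Set (absoluteGaloisGroup ℚ)) := (hH.inter hKo).inter hHFo
  set U : Set (absoluteGaloisGroup ℚ) := (fun σ => g⁻¹ * σ) ⁻¹' (H' : Set (absoluteGaloisGroup ℚ))
    with hU
  have hUo : IsOpen U := hH'o.preimage (continuous_const_mul g⁻¹)
  have hgU : g ∈ U := by
    change g⁻¹ * g ∈ H'
    rw [inv_mul_cancel]
    exact one_mem _
  -- the finite set of bad places
  have hS1 : {v : HeightOneSpectrum (𝓞 ℚ) | (N : 𝓞 ℚ) ∈ v.asIdeal}.Finite := by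
    have hne : Ideal.span {(N : 𝓞 ℚ)} ≠ ⊥ := by
      rw [Ne, Ideal.span_singleton_eq_bot]
      exact_mod_cast NeZero.ne N
    refine (Ideal.finite_factors hne).subset fun v hv => ?_
    simpa [Ideal.dvd_span_singleton] using hv
  have hS2 : {v : HeightOneSpectrum (𝓞 ℚ) |
      ¬ ∀ 𝔓 ∈ v.primesAbove, 𝔓.inertia (absoluteGaloisGroup ℚ) ≤ H}.Finite :=
    Filter.eventually_cofinite.mp (Literature.NumberTheory.EllipticCurves.eventually_forall_inertia_le H hH)
  have hS3 : {v : HeightOneSpectrum (𝓞 ℚ) |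
      ¬ ∀ 𝔓 ∈ v.primesAbove, 𝔓.inertia (absoluteGaloisGroup ℚ) ≤ HF}.Finite :=
    Filter.eventually_cofinite.mp (Literature.NumberTheory.EllipticCurves.eventually_forall_inertia_le HF hHFo)
  have hS4 : {v : HeightOneSpectrum (𝓞 ℚ) | ¬ Algebra.IsUnramifiedIn (𝓞 F) v.asIdeal}.Finite :=
    finite_setOf_not_isUnramifiedIn ℚ F
  set S : Set (HeightOneSpectrum (𝓞 ℚ)) :=
    (({v | (N : 𝓞 ℚ) ∈ v.asIdeal} ∪
      {v | ¬ ∀ 𝔓 ∈ v.primesAbove, 𝔓.inertia (absoluteGaloisGroup ℚ) ≤ H}) ∪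
      {v | ¬ ∀ 𝔓 ∈ v.primesAbove, 𝔓.inertia (absoluteGaloisGroup ℚ) ≤ HF}) ∪
      {v | ¬ Algebra.IsUnramifiedIn (𝓞 F) v.asIdeal} with hSdef
  have hS : S.Finite := ((hS1.union hS2).union hS3).union hS4
  -- Chebotarev: a Frobenius in `U` above a place outside `S`
  have hD := absoluteGaloisGroup.frobenius_dense
    Literature.NumberTheory.Automorphic.chebotarev_artinRep_holds ℚ S hS
  obtain ⟨σ, hσU, v, hvS, 𝔓, h𝔓, hσ⟩ := hD.inter_open_nonempty U hUo ⟨g, hgU⟩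
  have hv1 : (N : 𝓞 ℚ) ∉ v.asIdeal := fun h => hvS (Or.inl (Or.inl (Or.inl h)))
  have hv2 : ∀ 𝔓 ∈ v.primesAbove, 𝔓.inertia (absoluteGaloisGroup ℚ) ≤ H := by
    by_contra h; exact hvS (Or.inl (Or.inl (Or.inr h)))
  have hv3 : ∀ 𝔓 ∈ v.primesAbove, 𝔓.inertia (absoluteGaloisGroup ℚ) ≤ HF := by
    by_contra h; exact hvS (Or.inl (Or.inr h))
  have hv4 : Algebra.IsUnramifiedIn (𝓞 F) v.asIdeal := by
    by_contra h; exact hvS (Or.inr h)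
  have hσN : g⁻¹ * σ ∈ H := hσU.1.1
  have hσK : g⁻¹ * σ ∈ ω.ker := hσU.1.2
  have hσH : g⁻¹ * σ ∈ HF := hσU.2
  -- the prime `M` below `v`
  set M := Rat.HeightOneSpectrum.natGenerator v with hMdef
  have hMprime : M.Prime := Rat.HeightOneSpectrum.prime_natGenerator v
  have hMv : (M : 𝓞 ℚ) ∈ v.asIdeal := (Rat.natCast_mem_asIdeal_iff v).mpr dvd_rfl
  have huniqv : ∀ w : HeightOneSpectrum (𝓞 ℚ), (M : 𝓞 ℚ) ∈ w.asIdeal → w = v := fun w hw =>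
    Rat.natGenerator_injective ((Rat.natGenerator_eq_of_prime_mem w hMprime hw).trans rfl)
  -- `ω σ = M` and `ω g = ω σ`
  have hNP : (N : absIntegers (𝓞 ℚ) ℚ) ∉ 𝔓 := absIntegers.natCast_notMem_of_mem_primesAbove hv1 h𝔓
  have hωσ : (ω σ : ZMod N) = M := by
    rw [hω, modNCyclotomicCharacter_eq_residueCard_of_isArithFrobAt h𝔓 hNP hσ,
      Rat.residueCard_eq_natGenerator]
  have hωg : ω g = ω σ := by
    rw [MonoidHom.mem_ker, map_mul, map_inv, inv_mul_eq_one] at hσK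
    exact hσK
  -- `σ ∉ HF`, so `v` is inert in `F`
  have hσHF : σ ∉ HF := fun h => hg (by
    have := HF.mul_mem h (HF.inv_mem hσH)
    rwa [mul_inv_rev, inv_inv, mul_inv_cancel_left] at this)
  obtain ⟨w, -, -, hwv, huniq, -, -⟩ :=
    exists_place_inert_of_not_mem_range (F := ℚ) (M := F) hprime hHFn hHFi hv4 h𝔓 (hv3 𝔓 h𝔓)
      hσ hσHF
  have hspan : (Ideal.span {(M : 𝓞 F)}).IsPrime :=
    Rat.isPrime_span_natCast_of_unique_place F (Rat.asIdeal_eq_span_natGenerator v) hv4 hwv huniq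
  exact ⟨M, v, hMprime, hMv, hv1, huniqv, hspan, hv2, by rw [← hωσ, ← hωg], 𝔓, h𝔓, σ, hσ, hσN⟩

/-! ### The stub -/

/-- **stub_inertSupplyPrimeSq** (line `descend-raise-basechange`, skeleton v3, S1'): for `F`
imaginary quadratic, `p ≥ 5` and a continuous unit-valued `η : Γ_ℚ → ℚ̄_pˣ` with odd reduction
`η̄`, there is a prime `M ≠ p` INERT in `F` at which `η̄` is unramified, with `η̄(Frob_M) ≡ -1` at
every arithmetic Frobenius above `M` and `M ≡ -1 (mod p²)`.  Proof: Chebotarev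
(`exists_inert_prime_modN` with `N = p²`) for the residual kernel `H` of `η` and `g = c` a complex
conjugation: `η̄(Frob) = η̄(c) = -1` (conjugacy of the primes above `M`, inertia in `H`) and
`M ≡ χ_{p²}(c) = -1 (mod p²)`.  Billerey–Menares 2016, Thm. 2.2 (the use); Tate GCFT §2.4
(Chebotarev). [folklore] -/
theorem stub_inertSupplyPrimeSq :
    ∀ (F : Type) [Field F] [NumberField F], NumberField.IsTotallyComplex F → Module.finrank ℚ F = 2 →
      ∀ (p : ℕ) [Fact p.Prime], 5 ≤ p →
      ∀ (η : Field.absoluteGaloisGroup ℚ →ₜ* (PadicAlgCl p)ˣ),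
      (∀ τ, Valued.v ((η τ : (PadicAlgCl p)ˣ) : PadicAlgCl p) = 1) →
      (∀ c : Field.absoluteGaloisGroup ℚ, Literature.NumberTheory.GaloisRepresentations.IsComplexConjugation (Rat.castHom ℝ) c →
        Valued.v (((η c : (PadicAlgCl p)ˣ) : PadicAlgCl p) + 1) < 1) →
      ∃ M : ℕ, M.Prime ∧ M ≠ p ∧ (Ideal.span {(M : NumberField.RingOfIntegers F)}).IsPrime ∧
        (∀ w : IsDedekindDomain.HeightOneSpectrum (NumberField.RingOfIntegers ℚ), (M : NumberField.RingOfIntegers ℚ) ∈ w.asIdeal → ∀ 𝔓 ∈ w.primesAbove,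
          ∀ σ ∈ 𝔓.inertia (Field.absoluteGaloisGroup ℚ),
            Valued.v (((η σ : (PadicAlgCl p)ˣ) : PadicAlgCl p) - 1) < 1) ∧
        (∀ w : IsDedekindDomain.HeightOneSpectrum (NumberField.RingOfIntegers ℚ), (M : NumberField.RingOfIntegers ℚ) ∈ w.asIdeal → ∀ 𝔓 ∈ w.primesAbove,
          ∀ σ : Field.absoluteGaloisGroup ℚ, IsArithFrobAt (NumberField.RingOfIntegers ℚ) σ 𝔓 →
            Valued.v (((η σ : (PadicAlgCl p)ˣ) : PadicAlgCl p) + 1) < 1) ∧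
        M % (p ^ 2) = p ^ 2 - 1 := by
  intro F _ _ hF h2 p _ _hp5 η hunit hodd
  classical
  haveI : NeZero p := ⟨(Fact.out : p.Prime).ne_zero⟩
  haveI hN0 : NeZero (p ^ 2) := inferInstance
  haveI : NeZero ((p ^ 2 : ℕ) : ℚ) := NeZero.charZero
  haveI : FiniteDimensional ℚ F := Module.finite_of_finrank_eq_succ h2
  haveI : Algebra.IsQuadraticExtension ℚ F := ⟨h2⟩
  haveI : IsGalois ℚ F := inferInstance
  obtain ⟨Hη, hHη, hHηn, hHηo⟩ := exists_residualKernel η hunit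
  haveI := hHηn
  set ω := modNCyclotomicCharacter ℚ (p ^ 2) with hω
  -- a Frobenius in the class of complex conjugation, modulo `p²`
  obtain ⟨c, hc⟩ := exists_isComplexConjugation (K := ℚ) (Rat.castHom ℝ)
  have hcF := Rat.not_mem_range_absGaloisRestrict_of_isComplexConjugation F hF hc
  obtain ⟨M, v, hMprime, hMv, hNv, huniqv, hspan, hIN, hωg, 𝔓, h𝔓, σ, hσ, hσN⟩ :=
    exists_inert_prime_modN F h2 (p ^ 2) Hη hHηo hcF
  have hωc : (ω c : ZMod (p ^ 2)) = -1 := modNCyclotomicCharacter_of_isComplexConjugation hc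
  -- `M ≠ p` since `v ∤ p²`
  have hMp : M ≠ p := fun h => hNv (by
    rw [Nat.cast_pow, sq, ← h]
    exact v.asIdeal.mul_mem_left _ hMv)
  -- `M ≡ -1 (mod p²)`
  have hMmod : M % (p ^ 2) = p ^ 2 - 1 := by
    have hM1 : (M : ZMod (p ^ 2)) = ((p ^ 2 - 1 : ℕ) : ZMod (p ^ 2)) := by
      rw [← hωg, ← hω, hωc, Nat.cast_sub NeZero.one_le, ZMod.natCast_self, Nat.cast_one, zero_sub]
    have h := (ZMod.natCast_eq_natCast_iff' M (p ^ 2 - 1) (p ^ 2)).mp hM1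
    rwa [Nat.mod_eq_of_lt (Nat.sub_lt (NeZero.pos (p ^ 2)) one_pos)] at h
  refine ⟨M, hMprime, hMp, hspan, ?_, ?_, hMmod⟩
  · -- unramified: inertia above `M` lies in the residual kernel
    intro w hw 𝔓' h𝔓' i hi
    obtain rfl := huniqv w hw
    exact (hHη i).mp (hIN 𝔓' h𝔓' hi)
  · -- `η̄(Frob) = η̄(c) = -1` at every arithmetic Frobenius above `M`
    intro w hw 𝔓' h𝔓' σ' hσ'
    obtain rfl := huniqv w hw
    -- transport the Frobenius `σ` at `𝔓` to `𝔓'`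
    obtain ⟨τ, hτ⟩ := HeightOneSpectrum.exists_smul_eq_of_mem_primesAbove_holds h𝔓 h𝔓'
    have hconj : IsArithFrobAt (𝓞 ℚ) (τ * σ * τ⁻¹) 𝔓' := hτ ▸ hσ.conj τ
    have hi : σ' * (τ * σ * τ⁻¹)⁻¹ ∈ 𝔓'.inertia (absoluteGaloisGroup ℚ) :=
      hσ'.mul_inv_mem_inertia hconj
    have h1 := (hHη _).mp (hIN 𝔓' h𝔓' hi)
    have h2' := (hHη _).mp hσN
    have h3 := hodd c hc
    -- `η σ' = η(i) · η(c) · η(c⁻¹ σ)` in the abelian group `ℚ̄_pˣ`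
    have e1 : η σ' = η (σ' * (τ * σ * τ⁻¹)⁻¹) * η (τ * σ * τ⁻¹) := by
      rw [← map_mul, inv_mul_cancel_right]
    have e2 : η (τ * σ * τ⁻¹) = η σ := by rw [map_mul, map_mul, map_inv, mul_inv_cancel_comm]
    have e3 : η σ = η c * η (c⁻¹ * σ) := by rw [← map_mul, mul_inv_cancel_left]
    rw [e2, e3] at e1
    have hval : ((η σ' : (PadicAlgCl p)ˣ) : PadicAlgCl p) =
        ((η (σ' * (τ * σ * τ⁻¹)⁻¹) : (PadicAlgCl p)ˣ) : PadicAlgCl p) *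
          (((η c : (PadicAlgCl p)ˣ) : PadicAlgCl p) * ((η (c⁻¹ * σ) : (PadicAlgCl p)ˣ) : PadicAlgCl p)) := by
      rw [e1, Units.val_mul, Units.val_mul]
    set x := ((η (σ' * (τ * σ * τ⁻¹)⁻¹) : (PadicAlgCl p)ˣ) : PadicAlgCl p) with hx
    set y := ((η (c⁻¹ * σ) : (PadicAlgCl p)ˣ) : PadicAlgCl p) with hy
    set d := ((η c : (PadicAlgCl p)ˣ) : PadicAlgCl p) with hd
    have e : ((η σ' : (PadicAlgCl p)ˣ) : PadicAlgCl p) + 1 =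
        (x - 1) * (d * y) + (d * (y - 1) + (d + 1)) := by rw [hval]; ring
    rw [e]
    refine Valuation.map_add_lt _ ?_ (Valuation.map_add_lt _ ?_ h3)
    · rw [Valuation.map_mul, Valuation.map_mul, hd, hy, hunit, hunit, mul_one, mul_one]
      exact h1
    · rw [Valuation.map_mul, hd, hunit, one_mul]
      exact h2'

end Summit.Langlands.Langlands.Theorems.SkinnerWilesDefectOne.EisensteinProModularSeed
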